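import Mathlib
import HarnessLib

/-!
# Crux `NoFrozenEddyCollapse` (stmt-NavierStokesRegularity-1431), line `SketchIdeator1`:
  STUB `stub_pairingLimit` (convergence of pairings under locally uniform convergence)

Helper file (lands `--supports stmt-NavierStokesRegularity-1431`) for the registered stub
`stub_pairingLimit` of the skeleton `NoFrozenEddyCollapse` (card `shell-balance-edge-torsion`).
Pure measure theory / topology on `ℝ³`, no PDE: if `V(t) → U` locally uniformly on `ℝ³` as `t ↑ T`,
with `V(t)` continuous for `t` near `T` and `U` continuous, then for every continuous compactly
supported test field `ψ` the pairings converge, `∫ ⟪V(t), ψ⟫ → ∫ ⟪U, ψ⟫` as `t ↑ T`.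

Proof outline.  `K = tsupport ψ` is compact, so locally uniform convergence gives uniform
convergence on `K` (`TendstoLocallyUniformly.tendstoLocallyUniformlyOn` and
`tendstoLocallyUniformlyOn_iff_tendstoUniformlyOn_of_compact`).  Fix `ε > 0` and put
`δ = ε / (∫ ‖ψ‖ + 1)`.  Eventually in `t`, `V(t)` is continuous and `‖V(t) − U‖ < δ` on `K`; then
both pairing integrands are continuous with compact support (hence integrable), and
`|∫ ⟪V(t), ψ⟫ − ∫ ⟪U, ψ⟫| = |∫ ⟪V(t) − U, ψ⟫| ≤ ∫ δ ‖ψ‖ = δ ∫ ‖ψ‖ < ε`, the pointwise bound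
`‖⟪V(t) y − U y, ψ y⟫‖ ≤ δ ‖ψ y‖` holding on `K` by Cauchy–Schwarz and off `K` because `ψ y = 0`.
For `t` where `V(t)` is not continuous the integral is a junk value; this is irrelevant since
every step is `∀ᶠ t`.  Mathlib only.
-/

noncomputable section

open MeasureTheory Set Filter Topology Metric Function

namespace Summit.NavierStokesRegularity.NavierStokesRegularity.Theorems.NoFrozenEddyCollapse.ShellBalanceEdgeTorsion

/-- The pairing integrand `y ↦ ⟪V y, ψ y⟫` of a continuous field `V` against a continuous compactly
supported field `ψ` is integrable on `ℝ³` (continuous with compact support inside `support ψ`). -/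
private theorem integrable_inner_pairing
    {V ψ : EuclideanSpace ℝ (Fin 3) → EuclideanSpace ℝ (Fin 3)} (hV : Continuous V)
    (hψ : Continuous ψ) (hψc : HasCompactSupport ψ) :
    Integrable (fun y => (inner ℝ (V y) (ψ y) : ℝ)) :=
  (hV.inner hψ).integrable_of_hasCompactSupport
    (hψc.mono fun y hy => by contrapose! hy; simp_all)

/-- Sup-norm-times-`L¹` bound for pairings: if `V, U, ψ` are continuous, `ψ` has compact support
and `dist (U y) (V y) < δ` on `tsupport ψ`, then
`|∫ ⟪V, ψ⟫ − ∫ ⟪U, ψ⟫| ≤ δ ∫ ‖ψ‖`. -/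
private theorem abs_integral_inner_sub_le
    {V U ψ : EuclideanSpace ℝ (Fin 3) → EuclideanSpace ℝ (Fin 3)} {δ : ℝ} (hV : Continuous V)
    (hU : Continuous U) (hψ : Continuous ψ) (hψc : HasCompactSupport ψ)
    (hclose : ∀ y ∈ tsupport ψ, dist (U y) (V y) < δ) :
    |(∫ y, (inner ℝ (V y) (ψ y) : ℝ)) - ∫ y, (inner ℝ (U y) (ψ y) : ℝ)| ≤ δ * ∫ y, ‖ψ y‖ := by
  rw [← integral_sub (integrable_inner_pairing hV hψ hψc) (integrable_inner_pairing hU hψ hψc),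
    ← integral_const_mul, ← Real.norm_eq_abs]
  have hg : Integrable (fun y => δ * ‖ψ y‖) :=
    (hψ.integrable_of_hasCompactSupport hψc).norm.const_mul δ
  refine norm_integral_le_of_norm_le hg (Eventually.of_forall fun y => ?_)
  rw [← inner_sub_left]
  by_cases hy : y ∈ tsupport ψ
  · calc ‖(inner ℝ (V y - U y) (ψ y) : ℝ)‖ ≤ ‖V y - U y‖ * ‖ψ y‖ := norm_inner_le_norm _ _
      _ ≤ δ * ‖ψ y‖ := by
        gcongr
        rw [← dist_eq_norm, dist_comm]
        exact (hclose y hy).le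
  · have h0 : ψ y = 0 := image_eq_zero_of_notMem_tsupport hy
    simp [h0]

/-- **PAIRING LIMIT** (stub `stub_pairingLimit` of crux `NoFrozenEddyCollapse`, line
`SketchIdeator1`; convergence toolkit).  If `V(t) → U` locally uniformly on `ℝ³` as `t ↑ T`, with
`V(t)` continuous for `t` near `T` and `U` continuous, then for every continuous compactly supported
`ψ`, `∫ ⟪V(t), ψ⟫ → ∫ ⟪U, ψ⟫` as `t ↑ T`: locally uniform convergence is uniform on the compact
`tsupport ψ`, and `|∫ ⟪V(t) − U, ψ⟫| ≤ sup_{tsupport ψ} ‖V(t) − U‖ · ∫ ‖ψ‖`. -/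
theorem stub_pairingLimit :
    ∀ (T : ℝ) (V : ℝ → EuclideanSpace ℝ (Fin 3) → EuclideanSpace ℝ (Fin 3))
      (U ψ : EuclideanSpace ℝ (Fin 3) → EuclideanSpace ℝ (Fin 3)),
      TendstoLocallyUniformly V U (nhdsWithin T (Set.Iio T)) →
      (∀ᶠ t in nhdsWithin T (Set.Iio T), Continuous (V t)) → Continuous U →
      Continuous ψ → HasCompactSupport ψ →
      Tendsto (fun t : ℝ => ∫ y, inner ℝ (V t y) (ψ y)) (nhdsWithin T (Set.Iio T))
        (nhds (∫ y, inner ℝ (U y) (ψ y))) := by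
  intro T V U ψ hconv hVc hU hψ hψc
  -- locally uniform convergence is uniform convergence on the compact `tsupport ψ`
  have hunif : TendstoUniformlyOn V U (nhdsWithin T (Set.Iio T)) (tsupport ψ) :=
    (tendstoLocallyUniformlyOn_iff_tendstoUniformlyOn_of_compact hψc.isCompact).1
      hconv.tendstoLocallyUniformlyOn
  rw [Metric.tendstoUniformlyOn_iff] at hunif
  rw [Metric.tendsto_nhds]
  intro ε hε
  have hI1 : 0 < (∫ y, ‖ψ y‖) + 1 :=
    add_pos_of_nonneg_of_pos (integral_nonneg fun y => norm_nonneg _) one_pos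
  have hδ : 0 < ε / ((∫ y, ‖ψ y‖) + 1) := div_pos hε hI1
  filter_upwards [hVc, hunif _ hδ] with t hVt hclose
  rw [Real.dist_eq]
  calc |(∫ y, (inner ℝ (V t y) (ψ y) : ℝ)) - ∫ y, (inner ℝ (U y) (ψ y) : ℝ)|
      ≤ ε / ((∫ y, ‖ψ y‖) + 1) * ∫ y, ‖ψ y‖ :=
        abs_integral_inner_sub_le hVt hU hψ hψc hclose
    _ < ε / ((∫ y, ‖ψ y‖) + 1) * ((∫ y, ‖ψ y‖) + 1) := mul_lt_mul_of_pos_left (lt_add_one _) hδ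
    _ = ε := div_mul_cancel₀ ε hI1.ne'

end Summit.NavierStokesRegularity.NavierStokesRegularity.Theorems.NoFrozenEddyCollapse.ShellBalanceEdgeTorsion
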